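import Summits.Ventures.PercRepro.ProfilePointedCircuitClassesReplacementNullityThree

/-!
# PercRepro — THE ONE-POINT PER-SET INEQUALITY AT NULLITY 3 (`n = 9`, `ρ = 6`, no coloops): THE `4 / 3` DOUBLE COUNTING
(p5, gen 47; `proofs/P5-GM1.md` §69 ADDENDUM 2)

`thruCount_three_pair_le_of_nullity_three`: for every `c ≠ e`, `thru_3({c, e}) ≤ #{T ∈ BI_4 : c ∈ T, e ∉ T}` — every
demand `X ∋ c, e` has at least four replacement units `T ⊇ X − e` (`four_le_card_filter_replacement_three`), every unit
`T ∋ c` has at most three demands below it (`X ↦ X ∖ {c, e}` into the points of `T − c`), so `4 · #𝒟 ≤ 3 · #𝒰`.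
At nullity `4` the analogous statement is FALSE (§69 ADDENDUM 3).
-/

open scoped Matroid

namespace PercRepro.Cogirth

open Finset ThmH Skew Shadow Profile

variable {α : Type} [DecidableEq α] {N : Matroid α} [N.Finite]

section ReplacementNullityThreePS

/-- **THE ONE-POINT PER-SET INEQUALITY AT NULLITY 3**: on a coloop-free matroid with `#E = 9` and `ρ = 6`, for every
`c ≠ e`, the bi-independent `3`-sets through `{c, e}` are at most the bi-independent `4`-sets containing `c` and
avoiding `e` (indeed at most three quarters of them: `4 · #𝒟 ≤ 3 · #𝒰`). -/
theorem thruCount_three_pair_le_of_nullity_three (hn : (gr N).card = 9) (hR : rk N (gr N) = 6)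
    (hcf : ∀ x ∈ gr N, rk N ((gr N).erase x) = 6) {c e : α} (hce : c ≠ e) :
    thruCount N 3 ({c, e} : Finset α) ≤ ((biIndepSets N 4).filter (fun T => c ∈ T ∧ e ∉ T)).card := by
  unfold thruCount
  have hec : e ∉ ({c} : Finset α) := by
    rw [mem_singleton]
    exact fun h => hce h.symm
  have hpair : ({c, e} : Finset α) = insert e {c} := by
    rw [pair_comm]
  have key : ((biIndepSets N 3).filter (fun X => ({c, e} : Finset α) ⊆ X)).card * 4 ≤
      ((biIndepSets N 4).filter (fun T => c ∈ T ∧ e ∉ T)).card * 3 := by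
    refine card_mul_le_card_mul (fun (X T : Finset α) => X.erase e ⊆ T) ?_ ?_
    · -- every demand has at least four units above it
      intro X hX
      rw [mem_filter] at hX
      have he : e ∈ X := hX.2 (by rw [mem_insert, mem_singleton]; exact Or.inr rfl)
      have hc : c ∈ X := hX.2 (mem_insert_self c {e})
      have h4 := four_le_card_filter_replacement_three hn hR hcf hX.1 he
      refine h4.trans (card_le_card ?_)
      intro T hT
      rw [mem_filter] at hT
      rw [mem_bipartiteAbove, mem_filter]
      exact ⟨⟨hT.1, hT.2.2 (mem_erase.2 ⟨hce, hc⟩), hT.2.1⟩, hT.2.2⟩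
    · -- every unit has at most three demands below it
      intro T hT
      rw [mem_filter] at hT
      have hTc : (T.erase c).card = 3 := by
        rw [card_erase_of_mem hT.2.1, (mem_biIndepSets.1 hT.1).2.1]
      calc (((biIndepSets N 3).filter (fun X => ({c, e} : Finset α) ⊆ X)).bipartiteBelow
            (fun (X T : Finset α) => X.erase e ⊆ T) T).card
          ≤ ((T.erase c).powersetCard 1).card := ?_
        _ = 3 := by
          rw [card_powersetCard, hTc]
          decide
      apply card_le_card_of_injOn (fun X => X \ ({c, e} : Finset α))
      · intro X hX
        rw [mem_coe, mem_bipartiteBelow, mem_filter] at hX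
        obtain ⟨⟨hX3, hXC⟩, hXT⟩ := hX
        show X \ ({c, e} : Finset α) ∈ (T.erase c).powersetCard 1
        rw [mem_powersetCard]
        refine ⟨?_, ?_⟩
        · intro x hx
          rw [mem_sdiff, mem_insert, mem_singleton, not_or] at hx
          rw [mem_erase]
          exact ⟨hx.2.1, hXT (mem_erase.2 ⟨hx.2.2, hx.1⟩)⟩
        · rw [card_sdiff_of_subset hXC, (mem_biIndepSets.1 hX3).2.1, hpair, card_insert_of_notMem hec,
            card_singleton]
      · intro X₁ hX₁ X₂ hX₂ h
        rw [mem_coe, mem_bipartiteBelow, mem_filter] at hX₁ hX₂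
        have h₁ : X₁ \ ({c, e} : Finset α) ∪ {c, e} = X₁ := sdiff_union_of_subset hX₁.1.2
        have h₂ : X₂ \ ({c, e} : Finset α) ∪ {c, e} = X₂ := sdiff_union_of_subset hX₂.1.2
        rw [← h₁, ← h₂]
        exact congrArg (fun S => S ∪ ({c, e} : Finset α)) h
  omega

end ReplacementNullityThreePS

end PercRepro.Cogirth
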